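import Mathlib
import HarnessLib

/-!
# The biased Boolean cube: product weights, the coordinate-swap involution, resampling influences

Support file for the two-function O'Donnell–Saks–Schramm–Servedio (OSSS) inequality on GENERAL finite
product spaces `{0,1}^ι` with coordinate biases `p : ι → [0,1]` (`DecisionTreeCovarianceBiased.lean`),
itself the input of Hutchcroft's volume differential inequality for Bernoulli percolation
(`Literature/Probability/Percolation/HutchcroftVolume*.lean`).  The uniform-cube version of the
inequality is `DecisionTreeCovariance.lean` (finite sums over `Fin n → Bool`, every point weight `2⁻ⁿ`);
here every point `x : ι → Bool` carries the product weight
`wt p x = ∏_i (p_i if x_i else 1 - p_i)` and expectations are the finite sums `∑_x wt p x · F x`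
(no measure theory).  Proved here (all elementary, [folklore]):

* `sum_wt` (`∑_x wt p x = 1`), `wt_nonneg`, `wt_update` (factorisation off one coordinate);
* `sum_sum_wt_swap` — the coordinate-swap involution `(x, y) ↦ (x^{i→y_i}, y^{i→x_i})` preserves the
  product weight `wt x · wt y` of a pair of independent points, hence weighted double sums;
* `sum_wt_mul_coord` / `sum_wt_ite` — integrating out one coordinate: for `ψ` not depending on `x_i`,
  `∑_x wt x · a(x_i) ψ(x) = (p_i a(1) + (1-p_i) a(0)) ∑_x wt x · ψ x`;
* `infl p i g = ∑_{x,y} wt x · wt y · |g y − g(y^{i→x_i})|`, OSSS's resampling influence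
  `Inf_i^{ρ₁}[g] = E|g(y) − g(y^{(i)})|` (coordinate `i` re-randomised), and its evaluation
  `infl_eq : infl p i g = 2 p_i (1−p_i) ∑_y wt y |g(y^{i→1}) − g(y^{i→0})|`.

## References
* R. O'Donnell, M. Saks, O. Schramm, R. A. Servedio, *Every decision tree has an influential variable*,
  FOCS 2005, arXiv:cs/0508071, §3 (general product probability spaces; `Inf^{ρ₁}`). [OdonnellEtAl2005]
* R. O'Donnell, *Analysis of Boolean Functions*, CUP 2014, §8.4 (p-biased analysis), §8.6.
-/

namespace Literature.Probability.ODonnellSaksSchrammServedio2005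

open Finset Function

variable {ι : Type*}

/-- One-coordinate weight of the biased cube: `p_i` for `true`, `1 - p_i` for `false`. [folklore] -/
noncomputable def coordWt (p : ι → ℝ) (i : ι) (b : Bool) : ℝ := if b then p i else 1 - p i

/-- `coordWt p i true + coordWt p i false = 1`. [folklore] -/
private theorem coordWt_true_add_false (p : ι → ℝ) (i : ι) : coordWt p i true + coordWt p i false = 1 := by
  simp [coordWt]

/-- `coordWt` is nonnegative for biases in `[0,1]`. [folklore] -/
private theorem coordWt_nonneg {p : ι → ℝ} (h0 : ∀ i, 0 ≤ p i) (h1 : ∀ i, p i ≤ 1) (i : ι) (b : Bool) :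
    0 ≤ coordWt p i b := by
  unfold coordWt; split_ifs
  · exact h0 i
  · linarith [h1 i]

variable [Fintype ι] [DecidableEq ι]

/-- Product weight of a point of the biased cube, `w_p(x) = ∏_i coordWt p i (x i)`. [folklore] -/
noncomputable def wt (p : ι → ℝ) (x : ι → Bool) : ℝ := ∏ i, coordWt p i (x i)

/-- The weight of `x` off the coordinate `i`. [folklore] -/
noncomputable def erasedWt (p : ι → ℝ) (i : ι) (x : ι → Bool) : ℝ :=
  ∏ j ∈ univ.erase i, coordWt p j (x j)

omit [DecidableEq ι] in
/-- Product weights are nonnegative for biases in `[0,1]` (the `p`-biased product distribution is a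
probability distribution). [cite: ODonnell2014, §8.4 (p-biased product distribution)] -/
theorem wt_nonneg {p : ι → ℝ} (h0 : ∀ i, 0 ≤ p i) (h1 : ∀ i, p i ≤ 1) (x : ι → Bool) : 0 ≤ wt p x :=
  Finset.prod_nonneg fun i _ => coordWt_nonneg h0 h1 i (x i)

/-- Factorisation of the weight at one coordinate. [folklore] -/
private theorem wt_eq_mul_erasedWt (p : ι → ℝ) (i : ι) (x : ι → Bool) :
    wt p x = coordWt p i (x i) * erasedWt p i x := by
  unfold wt erasedWt
  rw [← Finset.mul_prod_erase univ (fun j => coordWt p j (x j)) (mem_univ i)]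

/-- `erasedWt p i` does not read coordinate `i`. [folklore] -/
private theorem erasedWt_update (p : ι → ℝ) (i : ι) (x : ι → Bool) (c : Bool) :
    erasedWt p i (update x i c) = erasedWt p i x := by
  unfold erasedWt
  refine Finset.prod_congr rfl fun j hj => ?_
  rw [update_of_ne (ne_of_mem_erase hj)]

/-- Weight of a point with one coordinate overwritten. [folklore] -/
private theorem wt_update (p : ι → ℝ) (i : ι) (x : ι → Bool) (c : Bool) :
    wt p (update x i c) = coordWt p i c * erasedWt p i x := by
  rw [wt_eq_mul_erasedWt p i, update_self, erasedWt_update]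

/-- The total weight is `1`: the `p`-biased product distribution is a probability distribution.
[cite: ODonnell2014, §8.4 (p-biased product distribution)] -/
theorem sum_wt (p : ι → ℝ) : ∑ x : ι → Bool, wt p x = 1 := by
  unfold wt
  rw [← Fintype.prod_sum fun i b => coordWt p i b]
  refine Finset.prod_eq_one fun i _ => ?_
  rw [Fintype.sum_bool, coordWt_true_add_false]

/-- The coordinate-swap involution on pairs of points preserves double sums. [folklore] -/
private theorem sum_sum_swap' (i : ι) (Φ : (ι → Bool) → (ι → Bool) → ℝ) :
    ∑ x, ∑ y, Φ x y = ∑ x, ∑ y, Φ (update x i (y i)) (update y i (x i)) := by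
  let σ : (ι → Bool) × (ι → Bool) → (ι → Bool) × (ι → Bool) :=
    fun q => (update q.1 i (q.2 i), update q.2 i (q.1 i))
  have hσ : Function.Involutive σ := by
    intro q
    obtain ⟨x, y⟩ := q
    simp only [σ, update_self, update_idem, update_eq_self]
  calc ∑ x, ∑ y, Φ x y = ∑ q : (ι → Bool) × (ι → Bool), Φ q.1 q.2 := (Fintype.sum_prod_type' _).symm
    _ = ∑ q : (ι → Bool) × (ι → Bool), Φ (σ q).1 (σ q).2 := by
        rw [← Equiv.sum_comp (hσ.toPerm σ) (fun q => Φ q.1 q.2)]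
        rfl
    _ = ∑ x, ∑ y, Φ (update x i (y i)) (update y i (x i)) :=
        Fintype.sum_prod_type' (fun x y => Φ (update x i (y i)) (update y i (x i)))

/-- The swap involution preserves the product weight of an independent pair. [folklore] -/
private theorem wt_update_mul_wt_update (p : ι → ℝ) (i : ι) (x y : ι → Bool) :
    wt p (update x i (y i)) * wt p (update y i (x i)) = wt p x * wt p y := by
  rw [wt_update, wt_update, wt_eq_mul_erasedWt p i x, wt_eq_mul_erasedWt p i y]
  ring

/-- WEIGHTED SWAP: `E_{x,y} Φ(x,y) = E_{x,y} Φ(x^{i→y_i}, y^{i→x_i})` for independent `x, y` of law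
`w_p ⊗ w_p` (exchanging one coordinate between two independent samples preserves the joint law — the
step "`u[t]` has the product distribution" of the OSSS hybrid argument).
[cite: OdonnellEtAl2005, §3.2 proof of Thm 3.1 (the hybrids u[t] are distributed as the input)] -/
theorem sum_sum_wt_swap (p : ι → ℝ) (i : ι) (Φ : (ι → Bool) → (ι → Bool) → ℝ) :
    ∑ x, ∑ y, wt p x * wt p y * Φ x y
      = ∑ x, ∑ y, wt p x * wt p y * Φ (update x i (y i)) (update y i (x i)) := by
  rw [sum_sum_swap' i (fun x y => wt p x * wt p y * Φ x y)]
  refine Finset.sum_congr rfl fun x _ => Finset.sum_congr rfl fun y _ => ?_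
  rw [wt_update_mul_wt_update]

/-- INTEGRATING OUT ONE COORDINATE: for `ψ` not depending on `x_i`,
`∑_x w(x) a(x_i) ψ(x) = (p_i a(1) + (1 - p_i) a(0)) ∑_x w(x) ψ(x)` (independence of the coordinates of
the `p`-biased product distribution). [cite: ODonnell2014, §8.4 (p-biased product distribution)] -/
theorem sum_wt_mul_coord (p : ι → ℝ) (i : ι) (a : Bool → ℝ) (ψ : (ι → Bool) → ℝ)
    (hψ : ∀ x c, ψ (update x i c) = ψ x) :
    ∑ x, wt p x * (a (x i) * ψ x) = (p i * a true + (1 - p i) * a false) * ∑ x, wt p x * ψ x := by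
  -- the flip involution `τ x = x^{i → ¬x_i}`
  let τ : (ι → Bool) → (ι → Bool) := fun x => update x i (!x i)
  have hτ : Function.Involutive τ := by
    intro x
    simp only [τ, update_self, update_idem, Bool.not_not, update_eq_self]
  -- `2 S(a) = c(a) R` with `R = ∑_x erasedWt ψ`
  have key : ∀ a' : Bool → ℝ, 2 * ∑ x, wt p x * (a' (x i) * ψ x)
      = (p i * a' true + (1 - p i) * a' false) * ∑ x, erasedWt p i x * ψ x := by
    intro a'
    have hflip : ∑ x, wt p x * (a' (x i) * ψ x) = ∑ x, wt p (τ x) * (a' ((τ x) i) * ψ (τ x)) :=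
      (Equiv.sum_comp (hτ.toPerm τ) (fun x => wt p x * (a' (x i) * ψ x))).symm
    rw [two_mul]
    nth_rewrite 2 [hflip]
    rw [← Finset.sum_add_distrib, Finset.mul_sum]
    refine Finset.sum_congr rfl fun x _ => ?_
    simp only [τ, update_self, hψ, wt_update]
    rw [wt_eq_mul_erasedWt p i x]
    rcases Bool.eq_false_or_eq_true (x i) with hx | hx
    · simp [hx, coordWt]; ring
    · simp [hx, coordWt]; ring
  have k1 := key a
  have k2 := key (fun _ => 1)
  simp only [one_mul, mul_one] at k2
  have h2 : p i + (1 - p i) = 1 := by ring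
  rw [h2, one_mul] at k2
  rw [← k2] at k1
  linarith

/-- Branching on `x_i` between two functions not depending on `x_i` averages them with weights
`p_i`, `1 - p_i` (independence of the coordinates of the `p`-biased product distribution).
[cite: ODonnell2014, §8.4 (p-biased product distribution)] -/
theorem sum_wt_ite (p : ι → ℝ) (i : ι) (ψ₁ ψ₀ : (ι → Bool) → ℝ)
    (h₁ : ∀ x c, ψ₁ (update x i c) = ψ₁ x) (h₀ : ∀ x c, ψ₀ (update x i c) = ψ₀ x) :
    ∑ x, wt p x * (if x i = true then ψ₁ x else ψ₀ x)
      = p i * ∑ x, wt p x * ψ₁ x + (1 - p i) * ∑ x, wt p x * ψ₀ x := by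
  have hsplit : ∀ x : ι → Bool, wt p x * (if x i = true then ψ₁ x else ψ₀ x)
      = wt p x * ((if x i = true then (1 : ℝ) else 0) * ψ₁ x)
        + wt p x * ((if x i = true then (0 : ℝ) else 1) * ψ₀ x) := by
    intro x; split_ifs <;> ring
  rw [Finset.sum_congr rfl (fun x _ => hsplit x), Finset.sum_add_distrib,
    sum_wt_mul_coord p i (fun b => if b = true then (1 : ℝ) else 0) ψ₁ h₁,
    sum_wt_mul_coord p i (fun b => if b = true then (0 : ℝ) else 1) ψ₀ h₀]
  simp

/-- A function of `x` alone integrates trivially against an independent second point: `∑_y w(y) = 1`.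
[cite: ODonnell2014, §8.4 (p-biased product distribution)] -/
theorem sum_sum_wt_mul_left (p : ι → ℝ) (F : (ι → Bool) → ℝ) :
    ∑ x, ∑ y, wt p x * wt p y * F x = ∑ x, wt p x * F x := by
  refine Finset.sum_congr rfl fun x _ => ?_
  have : ∑ y, wt p x * wt p y * F x = (wt p x * F x) * ∑ y, wt p y := by
    rw [Finset.mul_sum]; exact Finset.sum_congr rfl fun y _ => by ring
  rw [this, sum_wt, mul_one]

/-- OSSS's resampling influence `Inf_i^{ρ₁}[g] = E_{x,y} |g(y) − g(y^{i→x_i})|` (coordinate `i` of `y`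
replaced by an independent copy). [cite: OdonnellEtAl2005, §3.1 definition of Inf^{ρ} p. 6] -/
noncomputable def infl (p : ι → ℝ) (i : ι) (g : (ι → Bool) → ℝ) : ℝ :=
  ∑ x, ∑ y, wt p x * wt p y * |g y - g (update y i (x i))|

/-- Influences `Inf_i^{ρ₁}` are nonnegative (biases in `[0,1]`). [cite: OdonnellEtAl2005, §3.1 definition of Inf^{ρ} p. 6] -/
theorem infl_nonneg {p : ι → ℝ} (h0 : ∀ i, 0 ≤ p i) (h1 : ∀ i, p i ≤ 1) (i : ι)
    (g : (ι → Bool) → ℝ) : 0 ≤ infl p i g :=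
  Finset.sum_nonneg fun x _ => Finset.sum_nonneg fun y _ =>
    mul_nonneg (mul_nonneg (wt_nonneg h0 h1 x) (wt_nonneg h0 h1 y)) (abs_nonneg _)

/-- EVALUATION OF THE INFLUENCE: `Inf_i^{ρ₁}[g] = 2 p_i (1 - p_i) · E_y |g(y^{i→1}) − g(y^{i→0})|`.
[cite: OdonnellEtAl2005, §3.1 p. 6 (Inf^{ρ₁} for Boolean-valued coordinates)] -/
theorem infl_eq (p : ι → ℝ) (i : ι) (g : (ι → Bool) → ℝ) :
    infl p i g = 2 * p i * (1 - p i) * ∑ y, wt p y * |g (update y i true) - g (update y i false)| := by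
  unfold infl
  -- integrate out `x`: only `x_i` is read
  have hx : ∀ y : ι → Bool, ∑ x, wt p x * wt p y * |g y - g (update y i (x i))|
      = wt p y * (p i * |g y - g (update y i true)| + (1 - p i) * |g y - g (update y i false)|) := by
    intro y
    have h := sum_wt_mul_coord p i (fun b => |g y - g (update y i b)|) (fun _ => (1 : ℝ))
      (fun _ _ => rfl)
    simp only [mul_one, sum_wt] at h
    have h' : ∑ x, wt p x * wt p y * |g y - g (update y i (x i))|
        = wt p y * ∑ x, wt p x * |g y - g (update y i (x i))| := by
      rw [Finset.mul_sum]; exact Finset.sum_congr rfl fun x _ => by ring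
    rw [h', h]
  rw [Finset.sum_comm, Finset.sum_congr rfl (fun y _ => hx y)]
  -- the two one-sided differences are `[¬y_i]·D` and `[y_i]·D` with `D` not reading `y_i`
  set D : (ι → Bool) → ℝ := fun y => |g (update y i true) - g (update y i false)| with hD
  have hDinv : ∀ y c, D (update y i c) = D y := by
    intro y c; simp only [hD, update_idem]
  have hsum : ∀ y : ι → Bool,
      wt p y * (p i * |g y - g (update y i true)| + (1 - p i) * |g y - g (update y i false)|)
        = wt p y * ((if y i = true then (0 : ℝ) else p i) * D y)
          + wt p y * ((if y i = true then (1 - p i) else (0 : ℝ)) * D y) := by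
    intro y
    rcases Bool.eq_false_or_eq_true (y i) with hy | hy
    · have hu : update y i true = y := by rw [← hy]; exact update_eq_self i y
      simp only [hy, hD, hu, sub_self, abs_zero, mul_zero, zero_add]
      simp
    · have hu : update y i false = y := by rw [← hy]; exact update_eq_self i y
      simp only [hy, hD, hu, sub_self, abs_zero, mul_zero, add_zero]
      rw [abs_sub_comm]; simp
  rw [Finset.sum_congr rfl (fun y _ => hsum y), Finset.sum_add_distrib,
    sum_wt_mul_coord p i (fun b => if b = true then (0 : ℝ) else p i) D hDinv,
    sum_wt_mul_coord p i (fun b => if b = true then (1 - p i) else (0 : ℝ)) D hDinv]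
  simp only [if_true, Bool.false_eq_true, if_false]
  ring

end Literature.Probability.ODonnellSaksSchrammServedio2005
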